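import Mathlib
import Literature.Analysis.FluidPDE.Tao2016AveragedNS.RenormalisedCascadeWaves
import Literature.Analysis.FluidPDE.Tao2016AveragedNS.SelfSimilarCascadeBlowup
import Literature.Analysis.FluidPDE.Tao2016AveragedNS.ViscousEternalSolutions
import Literature.Analysis.FluidPDE.Tao2016AveragedNS.BoundedEternalSolutions
import Summits.NavierStokesRegularity.NavierStokesRegularity.Theses.TaoLadderRungTwoBreak
import Summits.NavierStokesRegularity.NavierStokesRegularity.Theorems.TaoLadderRungTwoBreakNoSurvivingEternalViscBddOneWakeCriterion
import Summits.NavierStokesRegularity.NavierStokesRegularity.Theorems.TaoLadderRungTwoBreakNoSurvivingEternalViscBddOneWakeEquivalence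
import Summits.NavierStokesRegularity.NavierStokesRegularity.Theorems.WakeRatchetAdmissibleEternalBoundCritical
import Summits.NavierStokesRegularity.NavierStokesRegularity.Theorems.WakeRatchetAdmissibleEternalBoundTerminal
import Summits.NavierStokesRegularity.NavierStokesRegularity.Theorems.WakeRatchetAdmissibleEternalBoundDyadic

/-!
# Crux `TaoLadderRungTwoBreak.NoSurvivingEternalViscBddOne` (stmt-NavierStokesRegularity-20419):
# the DYADIC MEMBER of (ρ0) follows from a CLASSICAL statement about ancient solutions of the
# Katz–Pavlović chain in critical variables

MODEL lattice ODEs only (Tao 2016 §1.2, §4, §6.4); nothing in this file is a statement about the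
Navier–Stokes equations, and no stub, crux, rung or summit is proved by it.

On the dyadic member `dyadicTable ∈ E₂(2)` an admissible inviscid eternal solution `W` is scalar
(components `≠ 0` vanish, tree `WakeRatchetDyadic.dyadic_apply_ne_zero`), non-negative
(`dyadic_nonneg`) and AUTOMATICALLY uniformly bounded (`uniformBound_dyadic`).  In the critical
variables `V_n(t) = (-t)⁻¹ W_n(-log(-t))₀ = Λ^n X_n(t)` (blow-up time `0`) the grading disappears:

  `V̇_n = Λ V_{n-1}² − Λ⁻¹ V_n V_{n+1}`  on `t < 0`,   `Λ = (1+ε₀)^{5/2}`,      (KP-crit)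

the action clause reads `∫_{-∞}^{0} |V_n| ≤ M` (all `n`), the forward clause reads «`V_n` bounded near
`0⁻`», and the terminal profile is `v_n = V_n(0⁻)` (physically `Λ^n X_n(t⋆)`, the stranded wake).  Hence
(`dyadic_not_survivingFwd_of_classical`, `dyadic_noSurviving_of_classical`):

**CLASSICAL FORM.**  Fix `ε₀ > 0`.  If every real solution `V : ℤ → (-∞,0) → ℝ` of (KP-crit) with
uniformly integrable shells and shells bounded near `0⁻` has terminal values with
`(1+ε₀)^{-4n} v_n² → 0` (`physWeight(1)^n v_n²`; K41 would be `v_n ≍ Λ^{2n/3}`, the threshold is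
`Λ^{4n/5} = (1+ε₀)^{2n}`), then NO admissible inviscid eternal solution of the dyadic member at scale
ratio `1+ε₀` is forward (S₁)-surviving — i.e. the dyadic slices of (ρ0) `NoSurvivingEternalBddOne`, of the
crux K1ᵛ(1) (ν̂ = 0) and of ⟨20205⟩'s `stub_eternalLiouville` all hold at that `ε₀` (no `UniformBound`
hypothesis is needed on the dyadic member).  `dyadic_noSurvivingEternalBdd_slice_of_classical` packages
the threshold form.  No positivity or type-I hypothesis appears in the classical statement (both are
automatic for admissible solutions and may be ADDED by whoever proves it: `dyadic_classical_hyp_nonneg`).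

HONEST LABEL: dictionary work (critical variables, tree `WakeRatchetCritical`/`WakeRatchetTerminal`) on
top of this hand's wake criterion; the classical statement itself — the fixed-base wake law of the KP
chain at base `Λ → 1` — is OPEN (in print only base `2^{5/2}`/viscous, BMR 2011); crux ⟨20419⟩, its
children and every NS statement remain OPEN.
-/

noncomputable section

-- the summit and its single sub-problem share the name (CONVENTIONS §1)
set_option linter.dupNamespace false

namespace Summit.NavierStokesRegularity.NavierStokesRegularity.Theorems.NoSurvivingEternalViscBddOne.WakeCriterion

open Filter Topology Set MeasureTheory
open Literature.Analysis.FluidPDE Literature.Analysis.FluidPDE.TaoCascade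
open Summit.NavierStokesRegularity.NavierStokesRegularity.Theses.TaoLadderRungTwoBreak
open Summit.NavierStokesRegularity.NavierStokesRegularity.Theorems.WakeRatchetCritical
  (hasDerivAt_negLogNeg hasDerivAt_invNeg integral_crit_eq tendsto_negLogNeg_nhdsLT_zero)
open Summit.NavierStokesRegularity.NavierStokesRegularity.Theorems.WakeRatchetTerminal
  (exists_norm_crit_le)
open Summit.NavierStokesRegularity.NavierStokesRegularity.Theorems.WakeRatchetDyadic
  (dyadic_hasDerivAt_apply dyadic_apply_ne_zero dyadic_nonneg uniformBound_dyadic)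

variable {ε₀ : ℝ}

/-- A vector of `ℝ⁴` supported on component `0` has norm `|x₀|`. [elementary] -/
theorem norm_eq_abs_of_support_zero {x : Em 4} (hx : ∀ j : Fin 4, j ≠ 0 → x j = 0) :
    ‖x‖ = |x 0| := by
  have h1 : x 1 = 0 := hx 1 (by decide)
  have h2 : x 2 = 0 := hx 2 (by decide)
  have h3 : x 3 = 0 := hx 3 (by decide)
  rw [EuclideanSpace.norm_eq, Fin.sum_univ_four, h1, h2, h3]
  simp only [Real.norm_eq_abs, abs_zero, ne_eq, OfNat.ofNat_ne_zero, not_false_eq_true, zero_pow,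
    add_zero]
  exact Real.sqrt_sq (abs_nonneg _)

section Dictionary

variable {W : ℤ → ℝ → Em 4}

/-- **(KP-crit) for the critical scalar variable.**  For an admissible inviscid eternal solution of the
dyadic member, `V_n(t) = (-t)⁻¹ W_n(-log(-t))₀` solves `V̇_n = Λ V_{n-1}² − Λ⁻¹ V_n V_{n+1}` on `t < 0`.
[cite: Tao2016AveragedNS, §1.2 (dyadic system), §4 Lemma 4.1 (4.8), §6.4; tree `dyadic_hasDerivAt_apply`, `hasDerivAt_negLogNeg`, `hasDerivAt_invNeg`] -/
theorem dyadic_crit_hasDerivAt (hW : IsEternal ε₀ dyadicTable W) (n : ℤ) {t : ℝ} (ht : t < 0) :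
    HasDerivAt (fun s : ℝ => (-s)⁻¹ * W n (-Real.log (-s)) 0)
      (bigLam ε₀ * ((-t)⁻¹ * W (n - 1) (-Real.log (-t)) 0) ^ 2
        - (bigLam ε₀)⁻¹ * (((-t)⁻¹ * W n (-Real.log (-t)) 0)
            * ((-t)⁻¹ * W (n + 1) (-Real.log (-t)) 0))) t := by
  have hW' : IsEternalVisc ε₀ 0 dyadicTable W := hW.isEternalVisc
  have hw := dyadic_hasDerivAt_apply hW' n (-Real.log (-t)) 0
  rw [if_pos rfl] at hw
  have hvc : viscCoef ε₀ 0 n (-Real.log (-t)) = 0 := by unfold viscCoef; ring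
  rw [hvc, add_zero, one_mul] at hw
  have hcomp := hw.scomp t (hasDerivAt_negLogNeg ht)
  have hprod := (hasDerivAt_invNeg ht).smul hcomp
  refine hprod.congr_deriv ?_
  simp only [Function.comp_apply, smul_eq_mul]
  ring

/-- The action clause in critical variables: `t ↦ |V_n(t)|` is integrable on `(-∞,0)` with
`∫_{t<0}|V_n| = ∫_ℝ ‖W_n‖` (scalar solution: `‖W_n(σ)‖ = |W_n(σ)₀|`).
[cite: Tao2016AveragedNS, §6.4; tree `integral_crit_eq`, `dyadic_apply_ne_zero`] -/
theorem dyadic_crit_action (hε : 0 < ε₀) (hW : IsEternal ε₀ dyadicTable W) :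
    ∃ M : ℝ, ∀ n : ℤ, IntegrableOn (fun t : ℝ => |(-t)⁻¹ * W n (-Real.log (-t)) 0|) (Iio 0) ∧
      ∫ t in Iio 0, |(-t)⁻¹ * W n (-Real.log (-t)) 0| ≤ M := by
  have hW' : IsEternalVisc ε₀ 0 dyadicTable W := hW.isEternalVisc
  obtain ⟨M, hM⟩ := hW.action
  refine ⟨M, fun n => ?_⟩
  have hfun : (fun t : ℝ => ‖(-t)⁻¹ • W n (-Real.log (-t))‖)
      = fun t : ℝ => |(-t)⁻¹ * W n (-Real.log (-t)) 0| := by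
    funext t
    rw [norm_smul, Real.norm_eq_abs,
      norm_eq_abs_of_support_zero (fun j hj => dyadic_apply_ne_zero hε hW' n hj _), abs_mul]
  have h := integral_crit_eq (W n)
  rw [hfun] at h
  exact ⟨h.1.1 (hM n).1, by rw [h.2 (hM n).1]; exact (hM n).2⟩

/-- The forward clause in critical variables: every `V_n` is bounded on some `[t₀, 0)`.
[cite: Tao2016AveragedNS, §6.4; tree `exists_norm_crit_le`] -/
theorem dyadic_crit_bdd (hε : 0 < ε₀) (hW : IsEternal ε₀ dyadicTable W) (n : ℤ) :
    ∃ t₀ : ℝ, t₀ < 0 ∧ ∃ P : ℝ, ∀ t : ℝ, t₀ ≤ t → t < 0 → |(-t)⁻¹ * W n (-Real.log (-t)) 0| ≤ P := by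
  have hW' : IsEternalVisc ε₀ 0 dyadicTable W := hW.isEternalVisc
  obtain ⟨t₀, ht₀, B, hB⟩ := exists_norm_crit_le hW' n
  refine ⟨t₀, ht₀, B, fun t h1 h2 => ?_⟩
  have h := hB t h1 h2
  rwa [norm_smul, Real.norm_eq_abs,
    norm_eq_abs_of_support_zero (fun j hj => dyadic_apply_ne_zero hε hW' n hj _), ← abs_mul] at h

/-- The terminal clause in critical variables: with `r` the terminal profile of `W`
(`e^{σ}W_n(σ) → r_n`), `V_n(t) → (r_n)₀` as `t → 0⁻`.
[cite: Tao2016AveragedNS, §6.4; tree `tendsto_negLogNeg_nhdsLT_zero`] -/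
theorem dyadic_crit_tendsto {r : ℤ → Em 4}
    (hr : ∀ k : ℤ, Tendsto (fun σ : ℝ => Real.exp σ • W k σ) atTop (𝓝 (r k))) (n : ℤ) :
    Tendsto (fun t : ℝ => (-t)⁻¹ * W n (-Real.log (-t)) 0) (𝓝[<] 0) (𝓝 (r n 0)) := by
  have hc : Continuous (fun x : Em 4 => x 0) := by fun_prop
  have h1 : Tendsto (fun t : ℝ => (Real.exp (-Real.log (-t)) • W n (-Real.log (-t))) 0)
      (𝓝[<] 0) (𝓝 (r n 0)) :=
    (hc.tendsto (r n)).comp ((hr n).comp tendsto_negLogNeg_nhdsLT_zero)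
  refine h1.congr' ?_
  filter_upwards [self_mem_nhdsWithin] with t ht
  rw [Real.exp_neg, Real.exp_log (neg_pos.2 ht)]
  rfl

/-- The terminal profile of a dyadic solution is supported on component `0`: `‖r_n‖² = (r_n)₀²`.
[cite: Tao2016AveragedNS, §1.2, §6.4; tree `dyadic_apply_ne_zero`] -/
theorem dyadic_terminal_norm_sq (hε : 0 < ε₀) (hW : IsEternal ε₀ dyadicTable W) {r : ℤ → Em 4}
    (hr : ∀ k : ℤ, Tendsto (fun σ : ℝ => Real.exp σ • W k σ) atTop (𝓝 (r k))) (n : ℤ) :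
    ‖r n‖ ^ 2 = (r n 0) ^ 2 := by
  have hW' : IsEternalVisc ε₀ 0 dyadicTable W := hW.isEternalVisc
  have hz : ∀ j : Fin 4, j ≠ 0 → r n j = 0 := by
    intro j hj
    have hc : Continuous (fun x : Em 4 => x j) := by fun_prop
    have h1 : Tendsto (fun σ : ℝ => (Real.exp σ • W n σ) j) atTop (𝓝 (r n j)) :=
      (hc.tendsto (r n)).comp (hr n)
    have h2 : (fun σ : ℝ => (Real.exp σ • W n σ) j) = fun _ => 0 := by
      funext σ
      rw [PiLp.smul_apply, dyadic_apply_ne_zero hε hW' n hj σ, smul_zero]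
    rw [h2] at h1
    exact (tendsto_nhds_unique tendsto_const_nhds h1).symm
  rw [norm_eq_abs_of_support_zero hz, sq_abs]

end Dictionary

/-! ## The classical statement implies the dyadic slice -/

/-- **CLASSICAL FORM ⇒ no survival on the dyadic member (fixed `ε₀`).**  If every real solution of
`V̇_n = ΛV_{n-1}² − Λ⁻¹V_nV_{n+1}` on `t < 0` with uniformly integrable shells and shells bounded near
`0⁻` has terminal values with `physWeight(1)^n v_n² = (1+ε₀)^{-4n} v_n² → 0`, then no admissible inviscid
eternal solution of `dyadicTable` at scale ratio `1+ε₀` is forward (S₁)-surviving.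
[cite: Tao2016AveragedNS, §1.2, §4 Thm. 4.2 (statement shape), §6.4; this file] -/
theorem dyadic_not_survivingFwd_of_classical (hε : 0 < ε₀)
    (hB : ∀ V : ℤ → ℝ → ℝ,
      (∀ (n : ℤ) (t : ℝ), t < 0 →
        HasDerivAt (V n) (bigLam ε₀ * V (n - 1) t ^ 2 - (bigLam ε₀)⁻¹ * (V n t * V (n + 1) t)) t) →
      (∃ M : ℝ, ∀ n : ℤ, IntegrableOn (fun t => |V n t|) (Iio 0) ∧ ∫ t in Iio 0, |V n t| ≤ M) →
      (∀ n : ℤ, ∃ t₀ : ℝ, t₀ < 0 ∧ ∃ P : ℝ, ∀ t : ℝ, t₀ ≤ t → t < 0 → |V n t| ≤ P) →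
      ∀ v : ℤ → ℝ, (∀ n : ℤ, Tendsto (V n) (𝓝[<] 0) (𝓝 (v n))) →
        Tendsto (fun n : ℕ => physWeight 1 ε₀ ^ n * v n ^ 2) atTop (𝓝 0))
    {W : ℤ → ℝ → Em 4} (hW : IsEternal ε₀ dyadicTable W) :
    ¬ EternalSurvivingFwd 1 ε₀ W := by
  have hW' : IsEternalVisc ε₀ 0 dyadicTable W := hW.isEternalVisc
  have hU : UniformBound W := uniformBound_dyadic hε hW
  obtain ⟨r, hr⟩ := exists_terminalProfile_fun hW'
  have hlim := hB (fun n t => (-t)⁻¹ * W n (-Real.log (-t)) 0)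
    (fun n t ht => dyadic_crit_hasDerivAt hW n ht) (dyadic_crit_action hε hW)
    (fun n => dyadic_crit_bdd hε hW n) (fun n => r n 0) (fun n => dyadic_crit_tendsto hr n)
  have hlim' : Tendsto (fun n : ℕ => physWeight 1 ε₀ ^ n * ‖r n‖ ^ 2) atTop (𝓝 0) := by
    have heq : (fun n : ℕ => physWeight 1 ε₀ ^ n * ‖r n‖ ^ 2)
        = fun n : ℕ => physWeight 1 ε₀ ^ n * (r n 0) ^ 2 := by
      funext n
      rw [dyadic_terminal_norm_sq hε hW hr]
    rw [heq]
    exact hlim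
  intro hS
  exact not_wakeFloor_of_tendsto_zero hlim' ((dyadic_survivingFwd_iff_wakeFloor hε hW hU hr).1 hS)

/-- **CLASSICAL FORM BELOW A THRESHOLD ⇒ the dyadic slices of (ρ0), of K1ᵛ(1)'s inviscid half and of
⟨20205⟩'s `stub_eternalLiouville`** (no `UniformBound` hypothesis: automatic on the dyadic member).
[cite: Tao2016AveragedNS, §1.2, §4 Thm. 4.2 (statement shape), §6.4; this file] -/
theorem dyadic_noSurvivingEternalBdd_slice_of_classical
    (hB : ∃ εs : ℝ, 0 < εs ∧ ∀ ε₀ : ℝ, 0 < ε₀ → ε₀ ≤ εs → ∀ V : ℤ → ℝ → ℝ,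
      (∀ (n : ℤ) (t : ℝ), t < 0 →
        HasDerivAt (V n) (bigLam ε₀ * V (n - 1) t ^ 2 - (bigLam ε₀)⁻¹ * (V n t * V (n + 1) t)) t) →
      (∃ M : ℝ, ∀ n : ℤ, IntegrableOn (fun t => |V n t|) (Iio 0) ∧ ∫ t in Iio 0, |V n t| ≤ M) →
      (∀ n : ℤ, ∃ t₀ : ℝ, t₀ < 0 ∧ ∃ P : ℝ, ∀ t : ℝ, t₀ ≤ t → t < 0 → |V n t| ≤ P) →
      ∀ v : ℤ → ℝ, (∀ n : ℤ, Tendsto (V n) (𝓝[<] 0) (𝓝 (v n))) →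
        Tendsto (fun n : ℕ => physWeight 1 ε₀ ^ n * v n ^ 2) atTop (𝓝 0)) :
    ∃ εs : ℝ, 0 < εs ∧ ∀ ε₀ : ℝ, 0 < ε₀ → ε₀ ≤ εs →
      ∀ W : ℤ → ℝ → Em 4, IsEternal ε₀ dyadicTable W → ¬ EternalSurvivingFwd 1 ε₀ W := by
  obtain ⟨εs, hεs, H⟩ := hB
  exact ⟨εs, hεs, fun ε₀ hε₀ hle W hW => dyadic_not_survivingFwd_of_classical hε₀ (H ε₀ hε₀ hle) hW⟩

/-- **What a prover of the classical form may assume for free**: the critical scalar variable of an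
admissible dyadic solution is non-negative (`dyadic_nonneg`) and obeys the type-I bound
`|V_n(t)| ≤ C/(-t)` (`uniformBound_dyadic`).  Recorded so that the classical statement can be attacked
in the positive, type-I class without loss.
[cite: Tao2016AveragedNS, §1.2, §6.4; tree `dyadic_nonneg`, `uniformBound_dyadic`] -/
theorem dyadic_classical_hyp_nonneg (hε : 0 < ε₀) {W : ℤ → ℝ → Em 4}
    (hW : IsEternal ε₀ dyadicTable W) :
    (∀ (n : ℤ) (t : ℝ), t < 0 → 0 ≤ (-t)⁻¹ * W n (-Real.log (-t)) 0) ∧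
      ∃ C : ℝ, ∀ (n : ℤ) (t : ℝ), t < 0 → |(-t)⁻¹ * W n (-Real.log (-t)) 0| ≤ C / (-t) := by
  have hW' : IsEternalVisc ε₀ 0 dyadicTable W := hW.isEternalVisc
  refine ⟨fun n t ht => mul_nonneg (inv_nonneg.2 (neg_pos.2 ht).le) (dyadic_nonneg hε hW' n _), ?_⟩
  obtain ⟨C, hC⟩ := uniformBound_dyadic hε hW
  refine ⟨C, fun n t ht => ?_⟩
  have hnt : 0 < -t := neg_pos.2 ht
  have h1 : |W n (-Real.log (-t)) 0| ≤ C := by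
    rw [← norm_eq_abs_of_support_zero (fun j hj => dyadic_apply_ne_zero hε hW' n hj _)]
    exact hC n _
  rw [abs_mul, abs_of_pos (inv_pos.2 hnt), div_eq_inv_mul]
  exact mul_le_mul_of_nonneg_left h1 (inv_pos.2 hnt).le

end Summit.NavierStokesRegularity.NavierStokesRegularity.Theorems.NoSurvivingEternalViscBddOne.WakeCriterion

end
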